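import Literature.NumberTheory.ComplexMultiplication.MainTheoremOfComplexMultiplication
import Literature.NumberTheory.ComplexMultiplication.CMPolarisationFrobeniusTransport
import Literature.NumberTheory.ComplexMultiplication.CMBalancedDivisorFiniteExtension
import Literature.NumberTheory.ComplexMultiplication.CMUniformizationWeilPairingRigidity
import Literature.NumberTheory.ComplexMultiplication.CMTypeUniformizationUnique
import Literature.AlgebraicGeometry.ComplexMultiplication.CMTypeRealisationOverNumberFieldUniformized
import HarnessLib

/-!
# The level-uniformisation split of the main theorem of complex multiplication (Shimura 1998, §18.6)

Topic `Literature/NumberTheory/ComplexMultiplication`, namespace `Literature.NumberTheory.ComplexMultiplication`.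
Cell `hodgecm-mathlib`, fan B-II row **II-1-S7** (junction) of B-plan1's b2-main-theorem-cm line (ruling S7 SPLIT
2026-08-28T04:29:16Z, text authority B-p12, block `S7Split-01ce2fb4fb9df665.lean`, typed verbatim by B-typ03): the
proof of [Shimura1998] Thm. 18.6 (pp. 125–129) is cut into three named `Prop`s joined by a kernel-checked one-liner.

* `IsLevelUniformization` — **the level-`N` uniformisation predicate** (junction of S7a/S7b): `ξ'` is a uniformisation
  of `((A₀ ⊗ ℂ)^σ, ι^σ)` of type `(K, Φ, 𝔟)`, `𝔟 = g(s)⁻¹𝔞`, satisfying Shimura's (∗∗∗) at level `N` (clause (2) for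
  `u ∈ N⁻¹𝔞`), the level's Frobenius arithmetic (`q`, `β`, `ν`) and the RELATIVE POLARISATION CLAUSE at the prime `ℓ`
  (p. 128 «X^σ corresponds to (g(d)g(d)^ρ)⁻¹pζ with respect to ξ′», divisor-free form);
* `levelStructure` — **S7a, the level-`N` structure** (pp. 125–129 up to (∗∗∗)): a level-independent `ν` and, for
  every level `N > 0` with `ℓ ∣ N`, some `ξ'_N, q, β` with `IsLevelUniformization … N ξ'_N q β ν`;
* `levelGluing` — **S7b, gluing two levels** (p. 129 «Now replace M by its multiple N … Thus ξ′ = ξ″»);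
* `modelReduction` — **S7c, model reduction** (p. 125 + p. 128): the two printed-citation facts
  `shimura1998_prop26_definedOverNumberField` (II-2) and `exists_balancedDivisor_finiteExtension` (II-1-S5b) together
  with S7a and S7b imply `shimura1998_thm18_6`;
* `shimura1998_thm18_6_of_levelStructure` — the join: S7c ∘ (S7a, S7b) ⊢ Thm. 18.6.

DEBT NOTE. `levelStructure`, `levelGluing`, `modelReduction` are three NAMED `Prop`s WITHOUT `_holds` here: they are
the TARGETS of the S7a / S7b / S7c `_holds` files of the line (B-p12 `MainTheoremCMLevelGluing.lean` →
`levelGluing_holds`, B-p20 S7c, S7a XL), not hypotheses of any Literature theorem; the route file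
b2-main-theorem-cm takes them by name (`def StubLevelGluing := levelGluing`, …).  No instance, no notation, no
attribute is declared here (typer lint); every binder is as in B-p12's kernel-checked block.

## References

* G. Shimura, *Abelian Varieties with Complex Multiplication and Modular Functions* (Princeton 1998), §18.6
  Thm. 18.6 (pp. 124–125) and its proof (pp. 125–129). [Shimura1998]
-/


noncomputable section

open CategoryTheory CategoryTheory.Limits AlgebraicGeometry NumberField IsDedekindDomain
open scoped NumberField nonZeroDivisors
open Literature.AlgebraicGeometry.Motives Literature.AlgebraicGeometry.Motives.AbelianVariety
open Literature.NumberTheory.ComplexMultiplication Literature.NumberTheory.NumberFields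
open Literature.AlgebraicGeometry.ComplexMultiplication
open Literature.NumberTheory.GaloisRepresentations (ideleGroup)

namespace Literature.NumberTheory.ComplexMultiplication

/-- **The level-`N` uniformisation predicate** (junction of S7a/S7b): `ξ'` is a uniformisation of
`((A₀ ⊗ ℂ)^σ, ι^σ)` of type `(K, Φ, 𝔟)`, `𝔟 = g(s)⁻¹𝔞`, satisfying Shimura's (∗∗∗) at level `N`
(clause (2) for `u ∈ N⁻¹𝔞`) and the RELATIVE POLARISATION CLAUSE at the prime `ℓ`: with the level's
Frobenius data `q = N𝔓`, `β = g(d₀)⁻¹` (so `β𝔟 = 𝔮⁻¹𝔞 ⊇ 𝔞`, `𝔮` prime to `ℓ`, `q·ββ^ρ = ν = N((s))`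
level-independent), `ē^{X^σ}_{ℓᵏ}(ξ'(u), ξ'(w)) = ē^{X}_{ℓᵏ}(ξ(x), ξ(y))^q` whenever `x ≡ βu`, `y ≡ βw`
`(mod β𝔟)` ([Shimura1998] p. 128 «X^σ corresponds to (g(d)g(d)^ρ)⁻¹pζ with respect to ξ′», divisor-free).
[cite: Shimura1998, §18.6 proof of Thm. 18.6, pp. 127–129] -/
def IsLevelUniformization {K : Type} [Field K] [NumberField K] [IsCMField K] (Φ : CMType K)
    [NumberField (traceField Φ)] (𝔞 𝔟 : (FractionalIdeal (𝓞 K)⁰ K)ˣ)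
    {L : Type} [Field L] [NumberField L] [Algebra L ℂ] (A₀ : AbelianVariety L) (ι₀ : 𝓞 K →+* End A₀)
    (X : CartierDivisor A₀.X.left)
    (πA : (A₀.baseChange ℂ).X.left ⟶ A₀.X.left) [IsDominant πA]
    (ξ : CMTypeUniformization Φ 𝔞 (A₀.baseChange ℂ) ((endBaseChange ℂ A₀).comp ι₀))
    (σ : ℂ ≃ₐ[traceField Φ] ℂ) (s : ideleGroup (traceField Φ))
    (πσ : ((A₀.baseChange ℂ).conjugate σ.toRingEquiv).X.left ⟶ (A₀.baseChange ℂ).X.left) [IsDominant πσ]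
    (ℓ : ℕ) [∀ k : ℕ, IsDominant (Hom.toSchemeHom (((ℓ ^ k : ℕ) : ℤ) • 𝟙 (A₀.baseChange ℂ)))]
    [∀ k : ℕ, IsDominant (Hom.toSchemeHom (((ℓ ^ k : ℕ) : ℤ) • 𝟙 ((A₀.baseChange ℂ).conjugate σ.toRingEquiv)))]
    (N : ℕ)
    (ξ' : CMTypeUniformization Φ 𝔟 ((A₀.baseChange ℂ).conjugate σ.toRingEquiv)
      (((A₀.baseChange ℂ).endConjugate σ.toRingEquiv).comp ((endBaseChange ℂ A₀).comp ι₀)))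
    (q : ℕ) (β ν : K) : Prop :=
  -- (∗∗∗) at level N: clause (2) of Thm. 18.6 for `u ∈ N⁻¹𝔞`
  (∀ u v : K, ((N : ℕ) : K) * u ∈ (𝔞 : FractionalIdeal (𝓞 K)⁰ K) →
    IdeleAction.ideleMulEquiv (reflexNormFinitePart K Φ (traceField Φ) s)⁻¹ (𝔞 : FractionalIdeal (𝓞 K)⁰ K)
        𝔞.ne_zero (Submodule.Quotient.mk u) = Submodule.Quotient.mk v →
      (A₀.baseChange ℂ).conjPoints σ.toRingEquiv (ξ.r u) = ξ'.r v) ∧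
  -- the level's Frobenius arithmetic
  β ≠ 0 ∧ 0 < q ∧ (q : K) * β * IsCMField.complexConj K β = ν ∧
  ((𝔞 : FractionalIdeal (𝓞 K)⁰ K) ≤ FractionalIdeal.spanSingleton (𝓞 K)⁰ β * (𝔟 : FractionalIdeal (𝓞 K)⁰ K)) ∧
  (∀ k : ℕ, ∃ t : 𝓞 K, ((ℓ ^ k : ℕ) : 𝓞 K) ∣ t - 1 ∧
    FractionalIdeal.spanSingleton (𝓞 K)⁰ ((t : K) * β) * (𝔟 : FractionalIdeal (𝓞 K)⁰ K) ≤
      (𝔞 : FractionalIdeal (𝓞 K)⁰ K)) ∧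
  -- the relative polarisation clause at ℓ-power levels
  (∀ (k : ℕ) (u w x y : K) (hu : ((ℓ ^ k : ℕ) : K) * u ∈ (𝔟 : FractionalIdeal (𝓞 K)⁰ K))
      (hw : ((ℓ ^ k : ℕ) : K) * w ∈ (𝔟 : FractionalIdeal (𝓞 K)⁰ K))
      (hx : ((ℓ ^ k : ℕ) : K) * x ∈ (𝔞 : FractionalIdeal (𝓞 K)⁰ K))
      (hy : ((ℓ ^ k : ℕ) : K) * y ∈ (𝔞 : FractionalIdeal (𝓞 K)⁰ K)),
      x - β * u ∈ FractionalIdeal.spanSingleton (𝓞 K)⁰ β * (𝔟 : FractionalIdeal (𝓞 K)⁰ K) →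
      y - β * w ∈ FractionalIdeal.spanSingleton (𝓞 K)⁰ β * (𝔟 : FractionalIdeal (𝓞 K)⁰ K) →
      ((A₀.baseChange ℂ).conjugate σ.toRingEquiv).weilPairingLevel ((X.pullback πA).pullback πσ)
          ⟨ξ'.r u, ξ'.r_nsmul_mem _ u hu⟩ ⟨ξ'.r w, ξ'.r_nsmul_mem _ w hw⟩ =
        ((A₀.baseChange ℂ).weilPairingLevel (X.pullback πA)
          ⟨ξ.r x, ξ.r_nsmul_mem _ x hx⟩ ⟨ξ.r y, ξ.r_nsmul_mem _ y hy⟩) ^ q)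

/-- **S7a — the level-`N` structure** (XL; Shimura pp. 125–129 up to (∗∗∗) and «X^σ corresponds to … with
respect to ξ′»): for a model `(A₀, ι₀)` of type `(K, Φ)` over a number field `L ⊂ ℂ`, a divisor `X` on `A₀`,
a uniformisation `ξ` of `A₀ ⊗ ℂ` of type `(K, Φ, 𝔞)`, `σ ∈ Aut(ℂ/K*)` with `σ = [s, K*]`, and a prime `ℓ`:
there is a level-independent `ν ∈ K` such that for every level `N > 0` with `ℓ ∣ N` there are `ξ'_N, q, β` with
`IsLevelUniformization … N ξ'_N q β ν`.  Inputs: W(i), S9, (C), S1, S2, S3 (+ glue), S8, TT (idèle + torsion via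
II-1-S5c), S5, `exists_reindex`, G-conj. [cite: Shimura1998, §18.6 proof of Thm. 18.6, pp. 125–129] -/
def levelStructure : Prop :=
  ∀ {K : Type} [Field K] [NumberField K] [IsCMField K] (Φ : CMType K) [NumberField (traceField Φ)]
    (𝔞 𝔟 : (FractionalIdeal (𝓞 K)⁰ K)ˣ)
    {L : Type} [Field L] [NumberField L] [Algebra L ℂ] (A₀ : AbelianVariety L) (ι₀ : 𝓞 K →+* End A₀)
    (_hA₀ : IsCMTypeRealisationOver Φ A₀ ι₀)
    (X : CartierDivisor A₀.X.left)
    (πA : (A₀.baseChange ℂ).X.left ⟶ A₀.X.left) (_hπA : πA = pullback.fst A₀.X.hom (bcSpec L ℂ))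
    [IsDominant πA]
    (ξ : CMTypeUniformization Φ 𝔞 (A₀.baseChange ℂ) ((endBaseChange ℂ A₀).comp ι₀))
    (σ : ℂ ≃ₐ[traceField Φ] ℂ) (s : ideleGroup (traceField Φ)) (_hs : IsArtinLift (traceField Φ) s σ)
    (_h𝔟 : 𝔟 = ideleMulIdealUnits (reflexNormFinitePart K Φ (traceField Φ) s)⁻¹ 𝔞)
    (πσ : ((A₀.baseChange ℂ).conjugate σ.toRingEquiv).X.left ⟶ (A₀.baseChange ℂ).X.left)
    (_hπσ : πσ = baseChangeHomFst σ.toRingEquiv.toRingHom (A₀.baseChange ℂ).X) [IsDominant πσ]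
    (ℓ : ℕ) [Fact ℓ.Prime]
    [_hdomA : ∀ k : ℕ, IsDominant (Hom.toSchemeHom (((ℓ ^ k : ℕ) : ℤ) • 𝟙 (A₀.baseChange ℂ)))]
    [_hdomσ : ∀ k : ℕ,
      IsDominant (Hom.toSchemeHom (((ℓ ^ k : ℕ) : ℤ) • 𝟙 ((A₀.baseChange ℂ).conjugate σ.toRingEquiv)))],
    ∃ ν : K, ∀ N : ℕ, 0 < N → ℓ ∣ N →
      ∃ (ξ' : CMTypeUniformization Φ 𝔟 ((A₀.baseChange ℂ).conjugate σ.toRingEquiv)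
          (((A₀.baseChange ℂ).endConjugate σ.toRingEquiv).comp ((endBaseChange ℂ A₀).comp ι₀)))
        (q : ℕ) (β : K), IsLevelUniformization Φ 𝔞 𝔟 A₀ ι₀ X πA ξ σ s πσ ℓ N ξ' q β ν

/-- **S7b — gluing two levels** (M–L; Shimura p. 129 «Now replace M by its multiple N … Thus ξ′ = ξ″»): if `X_ℂ`
is Rosati-balanced for `ι` with bounded `ℓ`-radical (S5b's clauses), two level uniformisations at levels
`N ∣ N'`, `3 ≤ N`, `ℓ ∣ N`, with the same `ν`, coincide: (Uq) gives `ξ″ = ξ′ ∘ b`, `b ∈ 𝔬^×`; the polarisation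
clauses give equal `ℓ`-power Weil pairings along `ξ′`, `ξ″` (the `a = (β/β′)t` computation), so the
(G)-engine yields `b b^ρ = 1`; Kronecker ⇒ `b` a root of unity; (2) at level `N` for both ⇒ `b ≡ 1 (mod N)`;
(U) ⇒ `b = 1`. [cite: Shimura1998, §18.6 proof of Thm. 18.6, p. 129] -/
def levelGluing : Prop :=
  ∀ {K : Type} [Field K] [NumberField K] [IsCMField K] (Φ : CMType K) [NumberField (traceField Φ)]
    (𝔞 𝔟 : (FractionalIdeal (𝓞 K)⁰ K)ˣ)
    {L : Type} [Field L] [NumberField L] [Algebra L ℂ] (A₀ : AbelianVariety L) (ι₀ : 𝓞 K →+* End A₀)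
    (X : CartierDivisor A₀.X.left)
    (πA : (A₀.baseChange ℂ).X.left ⟶ A₀.X.left) (_hπA : πA = pullback.fst A₀.X.hom (bcSpec L ℂ))
    [IsDominant πA]
    (ξ : CMTypeUniformization Φ 𝔞 (A₀.baseChange ℂ) ((endBaseChange ℂ A₀).comp ι₀))
    (σ : ℂ ≃ₐ[traceField Φ] ℂ) (s : ideleGroup (traceField Φ))
    (_h𝔟 : 𝔟 = ideleMulIdealUnits (reflexNormFinitePart K Φ (traceField Φ) s)⁻¹ 𝔞)
    (πσ : ((A₀.baseChange ℂ).conjugate σ.toRingEquiv).X.left ⟶ (A₀.baseChange ℂ).X.left)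
    (_hπσ : πσ = baseChangeHomFst σ.toRingEquiv.toRingHom (A₀.baseChange ℂ).X) [IsDominant πσ]
    (ℓ : ℕ) [Fact ℓ.Prime]
    [_hdomA : ∀ k : ℕ, IsDominant (Hom.toSchemeHom (((ℓ ^ k : ℕ) : ℤ) • 𝟙 (A₀.baseChange ℂ)))]
    [_hdomσ : ∀ k : ℕ,
      IsDominant (Hom.toSchemeHom (((ℓ ^ k : ℕ) : ℤ) • 𝟙 ((A₀.baseChange ℂ).conjugate σ.toRingEquiv)))]
    -- S5b's clauses for `X_ℂ = πA^* X` on `A₀ ⊗ ℂ` at `ℓ`: (bal) and (nd)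
    (_hros : ∀ (k : ℕ) (a : 𝓞 K) (P Q : (A₀.baseChange ℂ).torsionPoints ℂ ((ℓ ^ k : ℕ) : ℤ)),
      (A₀.baseChange ℂ).weilPairingLevel (X.pullback πA)
          ⟨AlgPoints.map (((endBaseChange ℂ A₀).comp ι₀) a).hom.hom.hom P.1,
            map_mem_torsionPoints (((endBaseChange ℂ A₀).comp ι₀) a) P.2⟩ Q =
        (A₀.baseChange ℂ).weilPairingLevel (X.pullback πA) P
          ⟨AlgPoints.map (((endBaseChange ℂ A₀).comp ι₀) (IsCMField.ringOfIntegersComplexConj K a)).hom.hom.hom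
              Q.1, map_mem_torsionPoints (((endBaseChange ℂ A₀).comp ι₀)
                (IsCMField.ringOfIntegersComplexConj K a)) Q.2⟩)
    (c : ℕ) (_hrad : ∀ (k : ℕ) (Q : (A₀.baseChange ℂ).torsionPoints ℂ ((ℓ ^ k : ℕ) : ℤ)),
      (∀ P : (A₀.baseChange ℂ).torsionPoints ℂ ((ℓ ^ k : ℕ) : ℤ),
          (A₀.baseChange ℂ).weilPairingLevel (X.pullback πA) P Q = 1) →
        (Q : (A₀.baseChange ℂ).Points ℂ) ^ (ℓ ^ c) = 1)
    (ν : K) (N N' : ℕ) (_hN : 3 ≤ N) (_hNN' : N ∣ N') (_hℓN : ℓ ∣ N)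
    (ξ' ξ'' : CMTypeUniformization Φ 𝔟 ((A₀.baseChange ℂ).conjugate σ.toRingEquiv)
      (((A₀.baseChange ℂ).endConjugate σ.toRingEquiv).comp ((endBaseChange ℂ A₀).comp ι₀)))
    (q q' : ℕ) (β β' : K),
    IsLevelUniformization Φ 𝔞 𝔟 A₀ ι₀ X πA ξ σ s πσ ℓ N ξ' q β ν →
    IsLevelUniformization Φ 𝔞 𝔟 A₀ ι₀ X πA ξ σ s πσ ℓ N' ξ'' q' β' ν →
      ∀ v : K, ξ''.r v = ξ'.r v

/-- **S7c — model reduction** (M; Shimura p. 125 «we may assume that A, A_i, ι, η_i are rational over an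
algebraic number field» + p. 128 «Let X be a basic polar divisor»): W(ii) (a number-field model of a structure
of type `(K, Φ, 𝔞)`, `exists_isCMTypeRealisationOver_uniformization_of_prop26`) + same-type iso
(`exists_iso_forall_map_r_eq`) + S5b (balanced divisor over a finite extension) reduce `shimura1998_thm18_6`
to the model case, where S7a at levels `N, N'` and S7b glue to one `ξ′` with (2) for all `u ∈ K`.
[cite: Shimura1998, §18.6 proof of Thm. 18.6, pp. 125, 128–129] -/
def modelReduction : Prop :=
  shimura1998_prop26_definedOverNumberField → exists_balancedDivisor_finiteExtension →
    levelStructure → levelGluing → shimura1998_thm18_6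

/-- The join (kernel-checked): S7c ∘ (S7a, S7b) ⊢ Thm. 18.6 from the two printed-citation facts.
[cite: Shimura1998, §18.6 Thm. 18.6] -/
theorem shimura1998_thm18_6_of_levelStructure (h7c : modelReduction)
    (h26 : shimura1998_prop26_definedOverNumberField) (h5b : exists_balancedDivisor_finiteExtension)
    (h7a : levelStructure) (h7b : levelGluing) :
    shimura1998_thm18_6 :=
  h7c h26 h5b h7a h7b

end Literature.NumberTheory.ComplexMultiplication

end
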